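import Summits.AtomisticToContinuum.HydrodynamicLimit.Theorems.AntiMazurCoboundariesCellForecastPressureDecayKinematicAssembly
import Summits.AtomisticToContinuum.HydrodynamicLimit.Theorems.AntiMazurCoboundariesCellForecastPressureDecayClusterTailNonFresh
import Summits.AtomisticToContinuum.HydrodynamicLimit.Theorems.AntiMazurCoboundariesCellForecastPressureDecayClusterTailFreshPairHit
import Summits.AtomisticToContinuum.HydrodynamicLimit.Theorems.AntiMazurCoboundariesCellForecastPressureDecayClusterTailDoubleCylinder
import Summits.AtomisticToContinuum.HydrodynamicLimit.Theorems.AntiMazurCoboundariesCellForecastPressureDecayClusterTailAssembly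
import Summits.AtomisticToContinuum.HydrodynamicLimit.Theorems.AntiMazurCoboundariesCellForecastPressureDecayContactStatistics
import HarnessLib

/-!
# S2 · equal-time Enskog kinematics of the canonical hard-sphere cell law, unconditionally
# (crux line `enskog-compensator-martingale`, crux `CellForecastPressureDecay`, stmt-AtomisticToContinuum-13915)

The closing file of stub S2 of the line (lead `prover-line-stmt-AtomisticToContinuum-13915-c3-0`, 2026-08-17):
`KinematicRates σ` for every `0 < σ < 3/16` — for every bounded continuous `w` there are `C, L₀` such that for every cell
`L ≥ L₀`, `n ≤ 2L³` and every cluster dynamics ONE static constant `c₂ ≥ 0` makes, for every continuous velocity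
functional `|F| ≤ 1` and every slab `Δ ∈ (0,1]`,
`|E_P[F(v(0)) · (∑ᵢ [w(vᵢ(Δ)) − w(vᵢ(0))] − Δ c₂ ∑_{i≠j} K_w(vᵢ,vⱼ))]| ≤ C (L³Δ² + L²Δ)`
(`K_w = pairKernel w`, the Enskog–Boltzmann pair kernel; `P = cellLaw σ L n Ψ`, free-boundary Euclidean hard-sphere
flow). It is the assembly `stub_kinematicAssemblyOfTail` (S2d′, p134971) fed with the landed statics S2a
`stub_cellLawFactorises` (p102145), S2b `stub_contactLayerBounds` (p112420), S2c `stub_contactStatistics` (p125100) and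
the short-time cluster tail S2e (`stub_clusterTail` / `clusterTail_holds`, p135118 — used here through its four landed
sub-goals `stub_clusterTail_{nonFresh,freshPairHit,doubleCylinder,assembly}`, p133822/p134519/p128654/p132645). This is the θ¹-input (predictable
part per slab) of every compensator / martingale line on this crux and on stmt-10967, and the fixed-σ, free-boundary,
density-uniform (`n ≤ 2L³`) form of the statement that the Boltzmann–Enskog collision operator gives the exact
first-order-in-time kinetics of the canonical hard-sphere gas (Lanford 1975 at `t = 0⁺`; Spohn 1991 §4.4; CIP 1994 §4.4).

References: O. E. Lanford III (1975) §§5–6; H. Spohn, *Large Scale Dynamics of Interacting Particles* (1991) §4.4;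
Cercignani–Illner–Pulvirenti (1994) §§2.2, 4.4.
-/

noncomputable section

namespace Summit.AtomisticToContinuum.HydrodynamicLimit.Theorems.EnskogCompensator

/-- **S2 · `KinematicRates σ` holds for every `0 < σ < 3/16`** (equal-time Enskog kinematics of the canonical
cell law is exact to first order in the slab length, with errors `C(L³Δ² + L²Δ)` uniform in the density `n/L³ ≤ 2`).
Registered stub `stub_kinematicRates` of the line `enskog-compensator-martingale`. [cite: Lanford1975, §§5–6] -/
theorem stub_kinematicRates : ∃ σ₀ : ℝ, 0 < σ₀ ∧ ∀ σ : ℝ, 0 < σ → σ < σ₀ → KinematicRates σ := by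
  obtain ⟨σ₁, hσ₁, hA⟩ := stub_kinematicAssemblyOfTail
  refine ⟨min σ₁ (3 / 16), by positivity, fun σ hσ hσlt => ?_⟩
  have h1 : σ < σ₁ := hσlt.trans_le (min_le_left _ _)
  have h316 : σ ≤ 3 / 16 := (hσlt.trans_le (min_le_right _ _)).le
  have hfac : CellLawFactorises σ := stub_cellLawFactorises σ
  have hclb : ContactLayerBounds σ := stub_contactLayerBounds σ hσ h316 hfac
  have hct : ClusterTail σ :=
    stub_clusterTail_assembly σ hσ h316 (stub_clusterTail_nonFresh σ hσ h316 hfac)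
      (stub_clusterTail_freshPairHit σ hσ h316 hfac) (stub_clusterTail_doubleCylinder σ hσ h316 hfac)
  exact hA σ hσ h1 hfac hclb (stub_contactStatistics σ hσ h316 hfac hclb) hct

/-- **S2, named**: `KinematicRates σ` for all `0 < σ < σ₀` with some `σ₀ > 0` (namely `min σ₁ (3/16)`).
[cite: Lanford1975, §§5–6] -/
theorem kinematicRates_holds : ∃ σ₀ : ℝ, 0 < σ₀ ∧ ∀ σ : ℝ, 0 < σ → σ < σ₀ → KinematicRates σ :=
  stub_kinematicRates

end Summit.AtomisticToContinuum.HydrodynamicLimit.Theorems.EnskogCompensator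

end
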